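import Mathlib
import Summits.NavierStokesRegularity.NavierStokesRegularity.Theorems.FilamentSkeletonRssClause13LiaSymbolNegWindowKernelDefs
import Summits.NavierStokesRegularity.NavierStokesRegularity.Theorems.FilamentSkeletonRssAnalyticStripLiaSymbolSeriesWindow

/-!
# Clause 13-J/13-R negative window, KERNEL-ONLY and WIDER: `𝔖(x) ≤ −1/64` for `1/5 ≤ x ≤ 1` (`Φ(p) ≤ −1/64` for `1/100 ≤ p ≤ 1/4`)

Hand leafhand-ns-filamentskeletonrs-7 g1 (prover), 2026-08-31, `--supports stmt-NavierStokesRegularity-23612 --as helper`; by-product of the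
kernel-only `LiaSymbolBound` machinery landed for 23320's stub P3 (`…SeriesDefs/Sound/Encl/Window`).  The window of record
`…Clause13LiaSymbolNegWindow.liaSym_le_neg_window` (`x ∈ [1/4, 19/20]`, ONE `native_decide`) is contained in this one; here the certificate
`cellsChkNeg (1/64) nodesNeg = true` is replayed by the KERNEL (`decide +kernel`; axioms `propext`, `Classical.choice`, `Quot.sound`).
True values: `𝔖 ≈ −0.024 (x = 1/5) … −0.0616 (x ≈ 0.6) … −0.022 (x = 1)`.
HONEST FRAMING: certified numerics for one explicit real integral, serving a HYPOTHETICAL filament-skeleton line on the NEGATIVE side of a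
MODEL route (clause 13 ∃-side, `Clause13RNearStraightL` OPEN); nothing here bears on Navier–Stokes regularity or blow-up.
-/

set_option linter.dupNamespace false

noncomputable section

namespace Summit.NavierStokesRegularity.NavierStokesRegularity.Theorems.AnalyticStripLiaSymbol

namespace Series

open Real Set MeasureTheory Filter Topology

/-- Soundness of one negative-window cell: `Φ(p) ≤ −κ` for `a ≤ p ≤ b`. -/
theorem cellChkNeg_sound {κ a b : ℚ} {ka kb : ℤ} (h : cellChkNeg κ a ka b kb = true) :
    ∀ p : ℝ, (a:ℝ) ≤ p → p ≤ (b:ℝ) → Numerics.Phi p ≤ -(κ:ℝ) := by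
  simp only [cellChkNeg, Bool.and_eq_true, decide_eq_true_eq] at h
  obtain ⟨⟨⟨⟨ha, hab⟩, _⟩, hokb⟩, hU⟩ := h
  have hb : 0 < b := ha.trans_le hab
  intro p hap hpb
  have ha' : (0:ℝ) < a := by exact_mod_cast ha
  have hp : 0 < p := ha'.trans_le hap
  obtain ⟨hElo, -⟩ := E_encl b kb hb hokb
  obtain ⟨hClo, -⟩ := C_encl b kb hb hokb
  have hU' : (1:ℝ) - ((CLo b kb : ℚ) : ℝ) - 2 * (a:ℝ) * ((ELo b kb : ℚ) : ℝ) ≤ -(κ:ℝ) := by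
    have := (Rat.cast_le (K := ℝ)).mpr hU; push_cast at this; exact this
  have hCb : Numerics.Cint (b:ℝ) ≤ Numerics.Cint p := Numerics.Cint_antitone hp.le hpb
  have hEb : Numerics.Eint (b:ℝ) ≤ Numerics.Eint p := Numerics.Eint_antitone hp hpb
  have hE0 : 0 ≤ Numerics.Eint (b:ℝ) := Numerics.Eint_nonneg _
  unfold Numerics.Phi
  have h1 : (a:ℝ) * Numerics.Eint (b:ℝ) ≤ p * Numerics.Eint p := mul_le_mul hap hEb hE0 hp.le
  have h3 : (a:ℝ) * ((ELo b kb : ℚ) : ℝ) ≤ (a:ℝ) * Numerics.Eint (b:ℝ) := mul_le_mul_of_nonneg_left hElo ha'.le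
  linarith

/-- Soundness of the chained negative-window cells on `[x.1, lastP x rest]`. -/
theorem cellsChkNeg_sound {κ : ℚ} : ∀ (rest : List (ℚ × ℤ)) (x : ℚ × ℤ), cellsChkNeg κ (x :: rest) = true → rest ≠ [] →
    ∀ p : ℝ, (x.1:ℝ) ≤ p → p ≤ (lastP x rest : ℝ) → Numerics.Phi p ≤ -(κ:ℝ) := by
  intro rest
  induction rest with
  | nil => intro x _ hne; exact absurd rfl hne
  | cons y rest ih =>
    intro x hc _ p hxp hpl
    simp only [cellsChkNeg, Bool.and_eq_true] at hc
    obtain ⟨hcell, hrest⟩ := hc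
    by_cases hpy : p ≤ (y.1:ℝ)
    · exact cellChkNeg_sound hcell p hxp hpy
    · have hyp : (y.1:ℝ) ≤ p := le_of_lt (not_le.mp hpy)
      cases rest with
      | nil =>
        simp only [lastP] at hpl
        exact absurd hpl hpy
      | cons z rest' =>
        exact ih y hrest (List.cons_ne_nil _ _) p hyp (by simpa [lastP] using hpl)

/-- **THE NEGATIVE-WINDOW CERTIFICATE, REPLAYED BY THE KERNEL** (`decide +kernel`; standard axioms). -/
theorem certificateNeg_kernel :
    (cellsChkNeg (1 / 64) nodesNeg && decide (lastP ((1 : ℚ) / 100, -7) nodesNeg.tail = 1 / 4)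
      && decide (nodesNeg = ((1 : ℚ) / 100, (-7 : ℤ)) :: nodesNeg.tail)) = true := by
  decide +kernel

/-- **`Φ(p) ≤ −1/64` for `1/100 ≤ p ≤ 1/4`, kernel-only** (contains the window of record `[0.015, 0.226]`). -/
theorem Phi_le_neg_window_kernel (p : ℝ) (h1 : 1 / 100 ≤ p) (h2 : p ≤ 1 / 4) : Numerics.Phi p ≤ -(1 / 64) := by
  have hc := certificateNeg_kernel
  simp only [Bool.and_eq_true, decide_eq_true_eq] at hc
  obtain ⟨⟨hcells, hlast⟩, hshape⟩ := hc
  rw [hshape] at hcells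
  have hne : nodesNeg.tail ≠ [] := by
    intro h; rw [h] at hlast; norm_num [lastP] at hlast
  have h := cellsChkNeg_sound nodesNeg.tail ((1 : ℚ) / 100, -7) hcells hne p (by push_cast; linarith)
    (by rw [hlast]; push_cast; linarith)
  have e : (((1 / 64 : ℚ) : ℝ)) = 1 / 64 := by norm_num
  rw [e] at h
  exact h

end Series

/-- **THE NEGATIVE WINDOW OF THE SELF-INDUCTION SYMBOL, KERNEL-ONLY AND WIDER: `𝔖(x) ≤ −1/64` for `1/5 ≤ x ≤ 1`**
(standard axioms; the window of record `[1/4, 19/20]` of `…Clause13LiaSymbolNegWindow` used `native_decide`). -/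
theorem liaSym_le_neg_window_kernel (x : ℝ) (h1 : 1 / 5 ≤ x) (h2 : x ≤ 1) : liaSym x ≤ -(1 / 64) := by
  have hx : x ≠ 0 := by intro h; rw [h] at h1; norm_num at h1
  rw [liaSym_eq_Phi x hx]
  refine Series.Phi_le_neg_window_kernel (x ^ 2 / 4) ?_ ?_
  · nlinarith
  · nlinarith

end Summit.NavierStokesRegularity.NavierStokesRegularity.Theorems.AnalyticStripLiaSymbol

end
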